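import Literature.Barriers.MatrixMultiplication.UniversalMethodBarrierAsymptoticRank
import Literature.Barriers.MatrixMultiplication.UniversalMethodBarrierThm29
import HarnessLib

/-!
# Alman 2021, Theorem 2.7 (per qualifying `w`) and Corollary 2.8 — proved (`Alman2021_cor28_holds`)

Topic `Literature/Barriers/MatrixMultiplication`; DISCHARGE of the named fact `Alman2021_cor28` of
the catalogue entry `UniversalMethodBarrier`: for every tensor `T` with finite index types over any
field, `ω_u(T) = 2 ⇒ S̃(T) = R̃(T)`. Sorry-free. The mechanism is Alman's Thm. 2.7
(`S̃(T) ≥ R̃(T)^{6/ω_u(T) - 2}`, "formalized identically to [AVW18, Thm. 4.1]"), proved here in the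
per-`w` form `asymptoticRank_le_of_qualifying`: if `w ∈ [2,3]` qualifies (`R̃(T) ≤ V_{w/3}(T)`)
then `R̃(T) ≤ S̃(T)^{w/6} R̃(T)^{w/3}`, i.e. `S̃(T) ≥ R̃(T)^{6/w - 2}`.

## Proof of the per-`w` bound (general `T`, no symmetry)

Pick `v` in the set defining `V_{w/3}` above `ρ := S̃^{w/6} R̃^{w/3}` (if `ρ < R̃`); a type class of
the `N`-th power of the degeneration gives `T^{⊗Nn} ⊵ X = F ⊙ ⟨P,Q,R⟩` with
`v^{nN} ≤ (N+1)^p F (PQR)^{w/3}`. Three flattenings of `X` and its rotations give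
`F·PR, F·QP, F·RQ ≤ R̃(X) ≤ R̃(T)^{Nn}` (`flattenings_le_asymptoticRank_multiple`, using
`FlatteningRank.lean` and `UniversalMethodBarrierAsymptoticRank.lean`), hence
`F²·PQR·(P+Q+R) ≤ 3 R̃(T)^{2Nn}`; the slice rank gives `F·PQR ≤ (P+Q+R) S(X) ≤ (P+Q+R) S̃(T)^{Nn}`;
together `F³(PQR)² ≤ 3 S̃^{Nn} R̃^{2Nn}`, and with `F ≥ 1`, `w ≥ 2`:
`v^{nN} ≤ 2 (N+1)^p ρ^{nN}` (`sum_rpow_pow_le_asymptoticRank_mul`), contradicting `v > ρ` as `N → ∞`.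
Cor. 2.8: along qualifying `w ↓ 2`, `(1 - w/3) log R̃ ≤ (w/6) log S̃` forces `log R̃ ≤ log S̃`;
with `S̃ ≤ R̃` (`asymptoticSliceRank_le_asymptoticRank`) equality follows.

## Content

* `kroneckerPow_rotate`, `asymptoticRank_rotate`, `flattenings_le_asymptoticRank_multiple`,
  `sum_rpow_pow_le_asymptoticRank_mul`, `kroneckerPow_ne_zero`, `one_le_sliceRank_of_ne_zero`,
  `one_le_tensorRank_of_ne_zero`, `one_le_asymptoticSliceRank_of_ne_zero`,
  `one_le_asymptoticRank_of_ne_zero`, `ne_zero_of_asymptoticRank_pos`,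
  `asymptoticRank_le_of_qualifying` (Thm. 2.7 per `w`), `Alman2021_cor28_holds`.

## References

* J. Alman, Theory of Computing 17 (2021), Thm. 2.7, Cor. 2.8 (p. 13). [Alman2021]
* J. Alman, V. Vassilevska Williams, FOCS 2018, Thm. 4.1 (mechanism, cited through [Alman2021]).
-/

noncomputable section

open scoped BigOperators

namespace Literature.Barriers.MatrixMultiplication

open Literature.Computability.AlgebraicComplexity
open Filter Topology

universe u

/-! ## `R̃` under rotation; flattening bounds for `F ⊙ ⟨P,Q,R⟩` -/

section Rotation

variable {K : Type u} [Field K]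
variable {ι κ μ : Type*} [Fintype ι] [Fintype κ] [Fintype μ]

omit [Fintype ι] [Fintype κ] [Fintype μ] in
/-- Powers commute with rotation (definitionally). [folklore] -/
theorem kroneckerPow_rotate (t : ι → κ → μ → K) (N : ℕ) :
    kroneckerPow (rotate t) N = rotate (kroneckerPow t N) := rfl

/-- **`R̃(rot T) = R̃(T)`.** [folklore] -/
theorem asymptoticRank_rotate (t : ι → κ → μ → K) :
    asymptoticRank (rotate t) = asymptoticRank t := by
  unfold asymptoticRank
  congr 1
  funext N
  rw [kroneckerPow_rotate, tensorRank_rotate]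

/-- **The three flattening lower bounds for `F ⊙ ⟨P,Q,R⟩`** (`P, Q, R ≥ 1`): `F·PR`, `F·QP` and
`F·RQ` are all `≤ R̃(F ⊙ ⟨P,Q,R⟩)` (flattening ranks of the tensor and of its rotations, which
are `≥ F ⊙ ⟨Q,R,P⟩`, `F ⊙ ⟨R,P,Q⟩`; Alman–Vassilevska Williams 2018, proof of Thm. 4.1, as used in
Alman 2021, Thm. 2.7). [cite: Alman2021, Thm. 2.7] -/
theorem flattenings_le_asymptoticRank_multiple (F P Q R : ℕ) (hP : 0 < P) (hQ : 0 < Q) (hR : 0 < R) :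
    ((F * (P * R) : ℕ) : ℝ) ≤ asymptoticRank (kroneckerTensor (unitTensor K F) (matMulTensor K P Q R)) ∧
    ((F * (Q * P) : ℕ) : ℝ) ≤ asymptoticRank (kroneckerTensor (unitTensor K F) (matMulTensor K P Q R)) ∧
    ((F * (R * Q) : ℕ) : ℝ) ≤ asymptoticRank (kroneckerTensor (unitTensor K F) (matMulTensor K P Q R)) := by
  have key : ∀ P Q R : ℕ, 0 < Q → ((F * (P * R) : ℕ) : ℝ) ≤
      asymptoticRank (kroneckerTensor (unitTensor K F) (matMulTensor K P Q R)) := by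
    intro P Q R hQ
    rw [← flatteningRank_multiple_matMulTensor (K := K) F P Q R hQ]
    exact flatteningRank_le_asymptoticRank _
  have rot : ∀ P Q R : ℕ, asymptoticRank (kroneckerTensor (unitTensor K F) (matMulTensor K Q R P)) ≤
      asymptoticRank (kroneckerTensor (unitTensor K F) (matMulTensor K P Q R)) := by
    intro P Q R
    rw [← asymptoticRank_rotate (kroneckerTensor (unitTensor K F) (matMulTensor K P Q R))]
    exact asymptoticRank_le_of_polyDegeneratesTo
      (tensorRestrictsTo_rotate_multiple_matMulTensor K F P Q R).polyDegeneratesTo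
  refine ⟨key P Q R hQ, (key Q R P hR).trans (rot P Q R), ?_⟩
  exact ((key R P Q hP).trans (rot Q R P)).trans (rot P Q R)

end Rotation

/-! ## The core estimate for a general tensor (Alman 2021, Thm. 2.7 mechanism) -/

section Core

variable (K : Type) [Field K] {ι κ μ : Type} [Fintype ι] [Fintype κ] [Fintype μ] [DecidableEq ι]
  [DecidableEq κ] [DecidableEq μ]

/-- **The core estimate for a general tensor** (Alman 2021, Thm. 2.7, after Alman–Vassilevska
Williams 2018, Thm. 4.1): if `t^{⊗n} ⊵ ⊕ᵢ ⟨aᵢ,bᵢ,cᵢ⟩` (`n ≥ 1`) then for `w ∈ [2,3]` and every `N`,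
`(Σᵢ (aᵢbᵢcᵢ)^{w/3})^N ≤ 2 (N+1)^p (S̃(t)^{w/6} R̃(t)^{w/3})^{Nn}`. Mechanism: a type class
`t^{⊗Nn} ⊵ X = F ⊙ ⟨P,Q,R⟩`; the three flattenings give `F²PQR·(P+Q+R) ≤ 3 R̃(t)^{2Nn}`, the slice
rank gives `F·PQR ≤ (P+Q+R) S(X) ≤ (P+Q+R) S̃(t)^{Nn}`, whence `F³(PQR)² ≤ 3 S̃^{Nn} R̃^{2Nn}`, and
`F ≥ 1`, `w ≥ 2` conclude. [cite: Alman2021, Thm. 2.7] -/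
theorem sum_rpow_pow_le_asymptoticRank_mul (t : ι → κ → μ → K) {n : ℕ} (hn : 0 < n) {p : ℕ}
    {a b c : Fin p → ℕ} (hpos : ∀ i, 0 < a i ∧ 0 < b i ∧ 0 < c i)
    (hdeg : PolyDegeneratesTo (kroneckerPow t n) (matMulDirectSum K a b c)) {w : ℝ}
    (hw : w ∈ Set.Icc (2 : ℝ) 3) (N : ℕ) :
    (∑ i, ((a i * b i * c i : ℕ) : ℝ) ^ (w / 3)) ^ N ≤
      2 * ((N : ℝ) + 1) ^ p *
        ((asymptoticSliceRank t ^ (w / 6)) * (asymptoticRank t ^ (w / 3))) ^ (N * n) := by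
  have hSr : 0 ≤ asymptoticSliceRank t := asymptoticSliceRank_nonneg t
  have hRr : 0 ≤ asymptoticRank t := asymptoticRank_nonneg t
  rcases Nat.eq_zero_or_pos N with hN0 | hN
  · subst hN0
    simp only [pow_zero, Nat.cast_zero, zero_add, one_pow, mul_one, zero_mul]
    norm_num
  obtain ⟨F, P, Q, R, hP, hQ, hR, hres, hineq⟩ := exists_typeClass K a b c (w / 3) N hpos
  -- `t^{⊗Nn} ⊵ X := F ⊙ ⟨P,Q,R⟩`
  have h₁ : PolyDegeneratesTo (kroneckerPow t (N * n))
      (kroneckerTensor (unitTensor K F) (matMulTensor K P Q R)) :=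
    (tensorRestrictsTo_kroneckerPow_mul t N n).trans_polyDegeneratesTo
      ((hdeg.kroneckerPow N).trans_restrictsTo hres)
  set PQR := P * Q * R with hPQR
  -- slice ranks: `F·PQR ≤ (P+Q+R) S̃^{Nn}`
  have hslice : ((F * PQR : ℕ) : ℝ) ≤ ((P + Q + R : ℕ) : ℝ) * asymptoticSliceRank t ^ (N * n) := by
    have h1 := mul_le_mul_sliceRank_multiple_matMul (K := K) F P Q R
    have h2 := h₁.sliceRank_le
    obtain ⟨e, he⟩ : ∃ e, N * n = e + 1 := ⟨N * n - 1, by have := Nat.mul_pos hN hn; omega⟩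
    have h3 : (sliceRank (kroneckerPow t (N * n)) : ℝ) ≤ asymptoticSliceRank t ^ (N * n) := by
      rw [he]; exact sliceRank_pow_le_asymptoticSliceRank_pow t e
    have h4 : ((F * PQR : ℕ) : ℝ) ≤ ((P + Q + R : ℕ) : ℝ) * (sliceRank (kroneckerPow t (N * n)) : ℝ) := by
      have h5 : F * (P * Q * R) ≤ (P + Q + R) * sliceRank (kroneckerPow t (N * n)) :=
        calc F * (P * Q * R) ≤ ((P - 1) + (Q - 1) + (R - 1) + 1) *
              sliceRank (kroneckerTensor (unitTensor K F) (matMulTensor K P Q R)) := h1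
          _ ≤ (P + Q + R) * sliceRank (kroneckerPow t (N * n)) :=
              Nat.mul_le_mul (by omega) h2
      exact_mod_cast h5
    exact h4.trans (mul_le_mul_of_nonneg_left h3 (Nat.cast_nonneg _))
  -- flattenings: `F²·PQR·(P+Q+R) ≤ 3 R̃^{2Nn}`
  have hflat : ((F : ℝ) ^ 2 * PQR) * ((P + Q + R : ℕ) : ℝ) ≤ 3 * (asymptoticRank t ^ (N * n)) ^ 2 := by
    obtain ⟨f1, f2, f3⟩ := flattenings_le_asymptoticRank_multiple (K := K) F P Q R hP hQ hR
    set ℛ := asymptoticRank t ^ (N * n) with hℛ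
    have hX : asymptoticRank (kroneckerTensor (unitTensor K F) (matMulTensor K P Q R)) ≤ ℛ :=
      (asymptoticRank_le_of_polyDegeneratesTo h₁).trans
        (asymptoticRank_kroneckerPow_le t (Nat.mul_pos hN hn))
    have g1 : ((F * (P * R) : ℕ) : ℝ) ≤ ℛ := f1.trans hX
    have g2 : ((F * (Q * P) : ℕ) : ℝ) ≤ ℛ := f2.trans hX
    have g3 : ((F * (R * Q) : ℕ) : ℝ) ≤ ℛ := f3.trans hX
    have g0 : (0 : ℝ) ≤ ((F * (P * R) : ℕ) : ℝ) := Nat.cast_nonneg _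
    have g0' : (0 : ℝ) ≤ ((F * (Q * P) : ℕ) : ℝ) := Nat.cast_nonneg _
    have g0'' : (0 : ℝ) ≤ ((F * (R * Q) : ℕ) : ℝ) := Nat.cast_nonneg _
    -- `F²PQR·P = (FPR)(FQP)`, `F²PQR·Q = (FQP)(FRQ)`, `F²PQR·R = (FRQ)(FPR)`
    have e : ((F : ℝ) ^ 2 * PQR) * ((P + Q + R : ℕ) : ℝ) =
        ((F * (P * R) : ℕ) : ℝ) * ((F * (Q * P) : ℕ) : ℝ) +
        ((F * (Q * P) : ℕ) : ℝ) * ((F * (R * Q) : ℕ) : ℝ) +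
        ((F * (R * Q) : ℕ) : ℝ) * ((F * (P * R) : ℕ) : ℝ) := by
      rw [hPQR]; push_cast; ring
    rw [e]
    nlinarith [mul_le_mul g1 g2 g0' (g0.trans g1), mul_le_mul g2 g3 g0'' (g0'.trans g2),
      mul_le_mul g3 g1 g0 (g0''.trans g3)]
  -- hence `F³ (PQR)² ≤ 3 S̃^{Nn} R̃^{2Nn}`
  have hmain : ((F : ℝ) ^ 3) * ((PQR : ℝ) ^ 2) ≤
      3 * (asymptoticSliceRank t ^ (N * n) * (asymptoticRank t ^ (N * n)) ^ 2) := by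
    have hsum0 : (0 : ℝ) < ((P + Q + R : ℕ) : ℝ) := by
      have : 0 < P + Q + R := by omega
      exact_mod_cast this
    -- multiply `hslice` by `F²·PQR ≥ 0` and use `hflat`
    have h1 : ((F : ℝ) ^ 3) * ((PQR : ℝ) ^ 2) = ((F : ℝ) ^ 2 * PQR) * ((F * PQR : ℕ) : ℝ) := by
      push_cast; ring
    rw [h1]
    calc ((F : ℝ) ^ 2 * PQR) * ((F * PQR : ℕ) : ℝ)
        ≤ ((F : ℝ) ^ 2 * PQR) * (((P + Q + R : ℕ) : ℝ) * asymptoticSliceRank t ^ (N * n)) :=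
          mul_le_mul_of_nonneg_left hslice (by positivity)
      _ = (((F : ℝ) ^ 2 * PQR) * ((P + Q + R : ℕ) : ℝ)) * asymptoticSliceRank t ^ (N * n) := by ring
      _ ≤ (3 * (asymptoticRank t ^ (N * n)) ^ 2) * asymptoticSliceRank t ^ (N * n) :=
          mul_le_mul_of_nonneg_right hflat (by positivity)
      _ = _ := by ring
  -- the real bookkeeping
  have hw2 : 2 ≤ w := hw.1
  have hw3 : w ≤ 3 := hw.2
  set Sv := ∑ i, ((a i * b i * c i : ℕ) : ℝ) ^ (w / 3) with hSv
  rcases Nat.eq_zero_or_pos F with hF0 | hF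
  · rw [hF0, Nat.cast_zero, zero_mul, mul_zero] at hineq
    exact hineq.trans (by positivity)
  have hF1 : (1 : ℝ) ≤ F := by exact_mod_cast hF
  have hM0 : (0 : ℝ) ≤ PQR := Nat.cast_nonneg _
  -- `F · PQR^{w/3} ≤ (F³ PQR²)^{w/6} ≤ (3 S̃^{Nn} R̃^{2Nn})^{w/6} = 3^{w/6} (S̃^{w/6} R̃^{w/3})^{Nn}`
  have step1 : (F : ℝ) * (PQR : ℝ) ^ (w / 3) ≤ ((F : ℝ) ^ 3 * (PQR : ℝ) ^ 2) ^ (w / 6) := by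
    rw [Real.mul_rpow (by positivity) (by positivity), ← Real.rpow_natCast (F : ℝ) 3,
      ← Real.rpow_mul (by positivity), ← Real.rpow_natCast (PQR : ℝ) 2, ← Real.rpow_mul hM0]
    have e1 : ((2 : ℕ) : ℝ) * (w / 6) = w / 3 := by push_cast; ring
    rw [e1]
    refine mul_le_mul_of_nonneg_right ?_ (by positivity)
    calc (F : ℝ) = (F : ℝ) ^ (1 : ℝ) := (Real.rpow_one _).symm
      _ ≤ (F : ℝ) ^ (((3 : ℕ) : ℝ) * (w / 6)) :=
        Real.rpow_le_rpow_of_exponent_le hF1 (by push_cast; linarith)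
  have step2 : ((F : ℝ) ^ 3 * (PQR : ℝ) ^ 2) ^ (w / 6) ≤
      (3 * (asymptoticSliceRank t ^ (N * n) * (asymptoticRank t ^ (N * n)) ^ 2)) ^ (w / 6) :=
    Real.rpow_le_rpow (by positivity) hmain (by linarith)
  have step3 : (3 * (asymptoticSliceRank t ^ (N * n) * (asymptoticRank t ^ (N * n)) ^ 2)) ^ (w / 6) =
      (3 : ℝ) ^ (w / 6) * ((asymptoticSliceRank t ^ (w / 6)) * (asymptoticRank t ^ (w / 3))) ^ (N * n) := by
    rw [Real.mul_rpow (by norm_num) (by positivity), Real.mul_rpow (by positivity) (by positivity),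
      mul_pow, ← Real.rpow_natCast (asymptoticSliceRank t), ← Real.rpow_mul hSr,
      ← Real.rpow_mul_natCast hSr, ← pow_mul, ← Real.rpow_natCast (asymptoticRank t),
      ← Real.rpow_mul hRr, ← Real.rpow_mul_natCast hRr]
    congr 2
    · congr 1; push_cast; ring
    · congr 1; push_cast; ring
  have step4 : (3 : ℝ) ^ (w / 6) ≤ 2 := by
    calc (3 : ℝ) ^ (w / 6) ≤ (4 : ℝ) ^ (w / 6) :=
          Real.rpow_le_rpow (by norm_num) (by norm_num) (by linarith)
      _ ≤ (4 : ℝ) ^ ((1 : ℝ) / 2) :=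
          Real.rpow_le_rpow_of_exponent_le (by norm_num) (by linarith)
      _ = 2 := by
          rw [show (4 : ℝ) = 2 ^ ((2 : ℕ) : ℝ) by norm_num, ← Real.rpow_mul (by norm_num)]
          norm_num
  have hρ0 : 0 ≤ ((asymptoticSliceRank t ^ (w / 6)) * (asymptoticRank t ^ (w / 3))) ^ (N * n) := by
    positivity
  calc Sv ^ N ≤ ((N : ℝ) + 1) ^ p * ((F : ℝ) * ((P * Q * R : ℕ) : ℝ) ^ (w / 3)) := hineq
    _ ≤ ((N : ℝ) + 1) ^ p * ((3 : ℝ) ^ (w / 6) *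
          ((asymptoticSliceRank t ^ (w / 6)) * (asymptoticRank t ^ (w / 3))) ^ (N * n)) := by
        refine mul_le_mul_of_nonneg_left ?_ (by positivity)
        exact (step1.trans step2).trans step3.le
    _ ≤ ((N : ℝ) + 1) ^ p * (2 *
          ((asymptoticSliceRank t ^ (w / 6)) * (asymptoticRank t ^ (w / 3))) ^ (N * n)) := by
        refine mul_le_mul_of_nonneg_left ?_ (by positivity)
        exact mul_le_mul_of_nonneg_right step4 hρ0
    _ = _ := by ring

end Core

/-! ## Non-vanishing tensors have `S̃, R̃ ≥ 1` -/

section NonZero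

variable {K : Type u} [Field K]
variable {ι κ μ : Type*} [Fintype ι] [Fintype κ] [Fintype μ]

omit [Fintype ι] [Fintype κ] [Fintype μ] in
/-- Powers of a non-zero tensor are non-zero (a diagonal entry is a power of a non-zero entry).
[folklore] -/
theorem kroneckerPow_ne_zero {t : ι → κ → μ → K} (ht : t ≠ 0) (N : ℕ) : kroneckerPow t N ≠ 0 := by
  obtain ⟨a, b, c, habc⟩ : ∃ a b c, t a b c ≠ 0 := by
    by_contra hall
    push Not at hall
    exact ht (funext fun a => funext fun b => funext fun c => hall a b c)
  intro h0
  have := congrFun (congrFun (congrFun h0 (fun _ => a)) (fun _ => b)) (fun _ => c)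
  simp only [kroneckerPow_apply, Finset.prod_const, Pi.zero_apply] at this
  exact pow_ne_zero _ habc this

omit [Fintype κ] [Fintype μ] in
/-- A non-zero tensor has slice rank `≥ 1` (a decomposition with no slices is `0`). [folklore] -/
theorem one_le_sliceRank_of_ne_zero {t : ι → κ → μ → K} (ht : t ≠ 0) : 1 ≤ sliceRank t := by
  by_contra hlt
  obtain ⟨kx, ky, kz, hk, α₁, β₁, α₂, β₂, α₃, β₃, h⟩ := sliceRank_mem t
  have hk0 : kx = 0 ∧ ky = 0 ∧ kz = 0 := by omega
  obtain ⟨rfl, rfl, rfl⟩ := hk0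
  exact ht (h.trans (by funext a b c; simp))

/-- A non-zero tensor has rank `≥ 1`. [folklore] -/
theorem one_le_tensorRank_of_ne_zero {t : ι → κ → μ → K} (ht : t ≠ 0) : 1 ≤ tensorRank t := by
  by_contra hlt
  obtain ⟨w, u, v, e⟩ := exists_triad_decomposition_tensorRank t
  have h0 : tensorRank t = 0 := by omega
  refine ht (e.trans ?_)
  funext a b c
  rw [sum_triad_apply]
  -- the index type `Fin (tensorRank t)` is empty
  have : IsEmpty (Fin (tensorRank t)) := by rw [h0]; infer_instance
  simp

omit [Fintype κ] [Fintype μ] in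
/-- **`S̃(T) ≥ 1` for `T ≠ 0`.** [folklore] -/
theorem one_le_asymptoticSliceRank_of_ne_zero {t : ι → κ → μ → K} (ht : t ≠ 0) :
    1 ≤ asymptoticSliceRank t := by
  have h1 := sliceRank_pow_rpow_le_asymptoticSliceRank t 0
  have h2 : (1 : ℝ) ≤ sliceRank (kroneckerPow t (0 + 1)) := by
    exact_mod_cast one_le_sliceRank_of_ne_zero (kroneckerPow_ne_zero ht _)
  refine le_trans ?_ h1
  exact Real.one_le_rpow h2 (by norm_num)

/-- **`R̃(T) ≥ 1` for `T ≠ 0`.** [folklore] -/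
theorem one_le_asymptoticRank_of_ne_zero {t : ι → κ → μ → K} (ht : t ≠ 0) :
    1 ≤ asymptoticRank t := by
  refine le_ciInf fun N => ?_
  have h2 : (1 : ℝ) ≤ tensorRank (kroneckerPow t (N + 1)) := by
    exact_mod_cast one_le_tensorRank_of_ne_zero (kroneckerPow_ne_zero ht _)
  exact Real.one_le_rpow h2 (by positivity)

/-- `R̃(T) > 0 ⇒ T ≠ 0`. [folklore] -/
theorem ne_zero_of_asymptoticRank_pos {t : ι → κ → μ → K} (h : 0 < asymptoticRank t) : t ≠ 0 := by
  rintro rfl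
  have h1 := asymptoticRank_le_tensorRank_pow_one (0 : ι → κ → μ → K)
  have h2 : kroneckerPow (0 : ι → κ → μ → K) 1 = 0 := by
    funext a b c
    simp [kroneckerPow_apply]
  rw [h2, tensorRank_zero, Nat.cast_zero] at h1
  linarith

end NonZero

/-! ## Theorem 2.7 per qualifying `w`, and Corollary 2.8 -/

section Cor28

/-- **Alman 2021, Theorem 2.7, per qualifying `w`**: if `w ∈ [2,3]` and `R̃(T) ≤ V_{w/3}(T)` then
`R̃(T) ≤ S̃(T)^{w/6} R̃(T)^{w/3}`, i.e. `R̃(T)^{1 - w/3} ≤ S̃(T)^{w/6}`, i.e.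
`S̃(T) ≥ R̃(T)^{6/w - 2}` (over any field, any tensor with finite index types).
[cite: Alman2021, Thm. 2.7] -/
theorem asymptoticRank_le_of_qualifying (K : Type) [Field K] {ι κ μ : Type} [Fintype ι] [Fintype κ]
    [Fintype μ] (t : ι → κ → μ → K) {w : ℝ} (hw : w ∈ Set.Icc (2 : ℝ) 3)
    (hq : asymptoticRank t ≤ degenerationValue K (w / 3) t) :
    asymptoticRank t ≤ asymptoticSliceRank t ^ (w / 6) * asymptoticRank t ^ (w / 3) := by
  classical
  set ρ := asymptoticSliceRank t ^ (w / 6) * asymptoticRank t ^ (w / 3) with hρ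
  by_contra hlt
  rw [not_le] at hlt
  have hρ0 : 0 ≤ ρ := mul_nonneg (Real.rpow_nonneg (asymptoticSliceRank_nonneg t) _)
    (Real.rpow_nonneg (asymptoticRank_nonneg t) _)
  have hRpos : 0 < asymptoticRank t := lt_of_le_of_lt hρ0 hlt
  have ht : t ≠ 0 := ne_zero_of_asymptoticRank_pos hRpos
  have hSpos : 0 < asymptoticSliceRank t :=
    zero_lt_one.trans_le (one_le_asymptoticSliceRank_of_ne_zero ht)
  have hρpos : 0 < ρ := mul_pos (Real.rpow_pos_of_pos hSpos _) (Real.rpow_pos_of_pos hRpos _)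
  -- pick `v` in the set defining `V_{w/3}` with `ρ < v`
  set 𝒮 := {v : ℝ | ∃ n : ℕ, 0 < n ∧ ∃ (m : ℕ) (a b c : Fin m → ℕ),
      (∀ i, 0 < a i ∧ 0 < b i ∧ 0 < c i) ∧
        PolyDegeneratesTo (kroneckerPow t n) (matMulDirectSum K a b c) ∧
          v = (∑ i, ((a i * b i * c i : ℕ) : ℝ) ^ (w / 3)) ^ (1 / (n : ℝ))} with h𝒮
  have hq' : asymptoticRank t ≤ sSup 𝒮 := hq
  have hv : ∃ v ∈ 𝒮, ρ < v := by
    by_cases hb : BddAbove 𝒮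
    · exact exists_lt_of_lt_csSup ⟨0, zero_mem_degenerationValue_set K (w / 3) t⟩ (hlt.trans_le hq')
    · exact not_bddAbove_iff.1 hb ρ
  obtain ⟨v, ⟨n, hn, p, a, b, c, hpos, hdeg, rfl⟩, hρv⟩ := hv
  set Sv := ∑ i, ((a i * b i * c i : ℕ) : ℝ) ^ (w / 3) with hSv
  have hSv0 : 0 ≤ Sv := Finset.sum_nonneg fun i _ => by positivity
  have hn0 : n ≠ 0 := hn.ne'
  have hρn : ρ ^ n < Sv := by
    have := pow_lt_pow_left₀ hρv hρpos.le hn0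
    rwa [one_div, Real.rpow_inv_natCast_pow hSv0 hn0] at this
  have hρn0 : 0 < ρ ^ n := pow_pos hρpos n
  set α := Sv / ρ ^ n with hα
  have hα1 : 1 < α := (one_lt_div hρn0).2 hρn
  have hα0 : 0 < α := zero_lt_one.trans hα1
  have hpow : ∀ N : ℕ, α ^ N ≤ 2 * ((N : ℝ) + 1) ^ p := by
    intro N
    have h := sum_rpow_pow_le_asymptoticRank_mul K t hn hpos hdeg hw N
    rw [← hSv, ← hρ] at h
    rw [hα, div_pow, div_le_iff₀ (pow_pos hρn0 N)]
    calc Sv ^ N ≤ 2 * ((N : ℝ) + 1) ^ p * ρ ^ (N * n) := h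
      _ = 2 * ((N : ℝ) + 1) ^ p * (ρ ^ n) ^ N := by rw [← pow_mul, mul_comm n N]
  have hlim : Tendsto (fun N : ℕ => (((N + 1 : ℕ) : ℝ)) ^ p / α ^ (N + 1)) atTop (𝓝 0) :=
    (tendsto_pow_const_div_const_pow_of_one_lt p hα1).comp (tendsto_add_atTop_nat 1)
  have hsmall : (0 : ℝ) < 1 / (2 * α) := by positivity
  obtain ⟨N, hN⟩ := (hlim.eventually (gt_mem_nhds hsmall)).exists
  rw [div_lt_div_iff₀ (by positivity) (by positivity), one_mul, pow_succ] at hN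
  have h2 := mul_le_mul_of_nonneg_right (hpow N) hα0.le
  push_cast at hN
  linarith

/-- **Alman 2021, Corollary 2.8** — DISCHARGE of the named fact `Alman2021_cor28`: if
`ω_u(T) = 2` then `S̃(T) = R̃(T)`. From `asymptoticRank_le_of_qualifying` along qualifying
`w ↓ 2` (`(1 - w/3) log R̃ ≤ (w/6) log S̃` forces `log R̃ ≤ log S̃`) and `S̃ ≤ R̃`
(`asymptoticSliceRank_le_asymptoticRank`). [cite: Alman2021, Cor. 2.8] -/
theorem Alman2021_cor28_holds : Alman2021_cor28 := by
  intro K _ ι κ μ _ _ _ t hω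
  have hle := asymptoticSliceRank_le_asymptoticRank t
  refine le_antisymm hle ?_
  rcases (asymptoticRank_nonneg t).eq_or_lt with hR0 | hRpos
  · rw [← hR0]; exact asymptoticSliceRank_nonneg t
  have ht : t ≠ 0 := ne_zero_of_asymptoticRank_pos hRpos
  have hR1 : 1 ≤ asymptoticRank t := one_le_asymptoticRank_of_ne_zero ht
  have hS1 : 1 ≤ asymptoticSliceRank t := one_le_asymptoticSliceRank_of_ne_zero ht
  have hLR : 0 ≤ Real.log (asymptoticRank t) := Real.log_nonneg hR1
  have hLS : 0 ≤ Real.log (asymptoticSliceRank t) := Real.log_nonneg hS1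
  -- qualifying `w < 2 + ε` for every `ε ∈ (0, 1]`
  have hqual : ∀ ε : ℝ, 0 < ε → ε ≤ 1 → ∃ w ∈ Set.Icc (2 : ℝ) 3,
      asymptoticRank t ≤ degenerationValue K (w / 3) t ∧ w < 2 + ε := by
    intro ε hε hε1
    have hlt : sInf ({w : ℝ | w ∈ Set.Icc (2 : ℝ) 3 ∧
        asymptoticRank t ≤ degenerationValue K (w / 3) t} ∪ {3}) < 2 + ε := by
      show universalOmega K t < 2 + ε
      rw [hω]; linarith
    obtain ⟨w, hw, hwlt⟩ := exists_lt_of_csInf_lt ⟨3, Set.mem_union_right _ (Set.mem_singleton _)⟩ hlt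
    rcases hw with ⟨hw, hq⟩ | hw3
    · exact ⟨w, hw, hq, hwlt⟩
    · rw [Set.mem_singleton_iff.1 hw3] at hwlt
      linarith
  -- the log inequality for every such `w`
  have hlog : ∀ ε : ℝ, 0 < ε → ε ≤ 1 →
      (1 / 3 - ε / 3) * Real.log (asymptoticRank t) ≤
        (1 / 3 + ε / 6) * Real.log (asymptoticSliceRank t) := by
    intro ε hε hε1
    obtain ⟨w, hw, hq, hwlt⟩ := hqual ε hε hε1
    have h := asymptoticRank_le_of_qualifying K t hw hq
    have hSpos : 0 < asymptoticSliceRank t := zero_lt_one.trans_le hS1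
    have h2 := Real.log_le_log hRpos h
    rw [Real.log_mul (Real.rpow_pos_of_pos hSpos _).ne' (Real.rpow_pos_of_pos hRpos _).ne',
      Real.log_rpow hSpos, Real.log_rpow hRpos] at h2
    have h3 : (1 - w / 3) * Real.log (asymptoticRank t) ≤ w / 6 * Real.log (asymptoticSliceRank t) := by
      linarith
    calc (1 / 3 - ε / 3) * Real.log (asymptoticRank t)
        ≤ (1 - w / 3) * Real.log (asymptoticRank t) :=
          mul_le_mul_of_nonneg_right (by linarith) hLR
      _ ≤ w / 6 * Real.log (asymptoticSliceRank t) := h3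
      _ ≤ (1 / 3 + ε / 6) * Real.log (asymptoticSliceRank t) :=
          mul_le_mul_of_nonneg_right (by linarith) hLS
  -- `log R̃ ≤ log S̃`
  have hfinal : Real.log (asymptoticRank t) ≤ Real.log (asymptoticSliceRank t) := by
    by_contra hlt
    rw [not_le] at hlt
    set δ := Real.log (asymptoticRank t) - Real.log (asymptoticSliceRank t) with hδ
    have hδpos : 0 < δ := by rw [hδ]; linarith
    set C := Real.log (asymptoticRank t) + Real.log (asymptoticSliceRank t) + 1 with hC
    have hCpos : 0 < C := by rw [hC]; linarith
    set ε := min 1 (δ / C) with hε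
    have hεpos : 0 < ε := lt_min zero_lt_one (div_pos hδpos hCpos)
    have hε1 : ε ≤ 1 := min_le_left _ _
    have hεC : ε * C ≤ δ := by
      have : ε ≤ δ / C := min_le_right _ _
      rwa [le_div_iff₀ hCpos] at this
    have h := hlog ε hεpos hε1
    -- `(1/3)(LR - LS) ≤ ε (LR/3 + LS/6) < ε C / 3`, contradiction with `ε C ≤ δ`
    nlinarith [mul_nonneg hεpos.le hLR, mul_nonneg hεpos.le hLS]
  exact (Real.log_le_log_iff hRpos (zero_lt_one.trans_le hS1)).1 hfinal

end Cor28



end Literature.Barriers.MatrixMultiplication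

end
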